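import Summits.QuantumFields.YangMills.Theorems.LuscherReductionTwistedTraceScalingBOSupportGeometry
import Summits.QuantumFields.YangMills.Theorems.LuscherReductionTwistedTraceScalingFPWeightRelative
import HarnessLib

/-!
# The fibre mass POINTWISE at rate: `mass(u) = γ_β(1 ± C(r + s² + (4R + orbitDist u)²))` and the mass RATIO `|mass(u)/mass(1) − 1| ≤ 4C·orbitDist(u)² + ε_N(β)` — F9e of the
# (N)-POINTWISE-AT-RATE brick
# (route `FlatTubeReduction`, crux K1 `NearFlatRatioLaw` stmt-QuantumFields-24720; seat `ym-line-ftr-p1` g14; rate twin «ratepack-v3 / frozen fibres»; R2b1 RECORD rung — no summit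
# statement is proved here)

WHY (memo `Cruxes/NearFlatRatioLaw/Lines/ratepack-v3-frozen-g12.md` §8).  For a FROZEN profile the fibre mass `mass(u) = ∫ Ω(v)²(N/χ)(orthoTube u v) dπ(v)` varies with the slow point
through the Faddeev–Popov factor; lane A's (B-N) brick (`fibreMass_brick`) gives `γ(1 ± κ)` with `κ` UNIFORM (`O(δ²) = O(λ_b)` on the `β^{-1/6}` window), too weak for the rate twin's
normalised dressing `W̃/√m̂`, `m̂ = mass(u)/mass(1)` (`…DressedWeightNormalised`), which needs `|m̂ − 1| ≤ κ_N·orbitDist(u)² + O(λ_b²)`.  With the pointwise FP weight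
(`fpWeight_pointwise_eventually`, F9d) and the fibre geometry (`‖(orthoTube u v)_e − 1‖_F ≤ 4R + orbitDist u` on the profile support `‖x‖ ≤ R`) this is bookkeeping:
* `fibreMass_sandwich_at` — lane A's `fibreMass_brick` with the (P) sandwich assumed only ALONG THE FIBRE over `u` (proof adapted verbatim);
* `abs_div_sub_one_le_of_near` — the algebra of the ratio;
* ★★★ `fibreMass_pointwise_of_sandwich` — at a fixed `β`, GIVEN the pointwise FP sandwich `N̄(1 − C(a + τ_U²)) ≤ N(U) ≤ N̄(1 + C(a + τ_U²))` on the fat tube (the conclusion of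
  `fpWeight_pointwise_eventually`, F9d, with `a = r + δg²`): `|mass(u) − γ| ≤ C(a + (4R + orbitDist u)²)·γ` on the window `orbitDist ≤ δ₁`, and, when `γ > 0` and `C(a + 16R²) ≤ ½`,
  `|mass(u)/mass(1) − 1| ≤ 4C·orbitDist(u)² + (4Ca + 96C·R²)`.
HONEST FRAMING: bookkeeping on lane A's landed tool-chain; the eventually-in-`β` record instance (F9d + `…FibreMassRecordNumerology`) and the normalised profile's `hN` are the next files;
femto rung R2b1 (RECORD label); not infinite volume, not a gap, not Clay.  No defs, no named facts, no `sorry`.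
-/

set_option autoImplicit false

noncomputable section

open MeasureTheory Filter Topology Real Module
open scoped BigOperators
open Literature.MathematicalPhysics.QuantumFieldTheory
open Literature.MathematicalPhysics.QuantumLattice

namespace Summit.QuantumFields.YangMills.Theorems.FemtoTransferGap.TwoLattice.ConstTube

open Summit.QuantumFields.YangMills.Theorems.FemtoTransferGap
open Summit.QuantumFields.YangMills.Theorems.FemtoTransferGap.TwoLattice.Avg
open Summit.QuantumFields.YangMills.Theorems.FemtoTransferGap.TwoLattice.Stiff (LinkSpace)

variable {L : ℕ} [NeZero L]

/-! ## §1 The (B-N) brick with the sandwich assumed only along the fibre -/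

/-- **FIBRE-MASS SANDWICH AT `u`.**  `χ = 𝟙_F·e^{−gaugeCoordSq/δg²}`, `Ω` bounded measurable with norm-bounded support, and along the fibre over `u` — at every `orthoTube u v` with
`v ∈ supp Ω` on the cap — membership in `F` and `N ∈ N̄[1−κ,1+κ]`.  Then `|fibreMass (N/χ) Ω u − γ| ≤ κγ`, `γ = boGamma Ω δg N̄`.  (Lane A's `fibreMass_brick` with the (P) hypothesis
restricted to the fibre; proof adapted from `…FibreMassBrick`.) [cite: Luscher1983, §3] -/
theorem fibreMass_sandwich_at {F : Set (GaugeConfig 3 L SU2)} {δg : ℝ} {χ : GaugeConfig 3 L SU2 → ℝ}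
    (hχ : ∀ U, χ U = F.indicator (fun _ => (1 : ℝ)) U * Real.exp (-(gaugeCoordSq L U / δg ^ 2))) (hχm : Measurable χ)
    {Nbar κ : ℝ} {Ω : LinkSpace L → ℝ} (hΩ : Measurable Ω) {CΩ : ℝ} (hCΩ : ∀ x, |Ω x| ≤ CΩ) {R : ℝ} (hΩR : ∀ x, Ω x ≠ 0 → ‖x‖ ≤ R)
    {u : GaugeConfig 3 1 SU2} (hu : ∀ v ∈ capBalancedSet L, Ω (linkEmbed L v) ≠ 0 → orthoTube L u v ∈ F ∧
      Nbar * (1 - κ) ≤ gaugeAvg χ (orthoTube L u v) ∧ gaugeAvg χ (orthoTube L u v) ≤ Nbar * (1 + κ)) :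
    |fibreMass L (softWeight χ) Ω u - boGamma L Ω δg Nbar| ≤ κ * boGamma L Ω δg Nbar := by
  -- adapted from lane A: `fibreMass_brick` (…TwistedTraceScalingFibreMassBrick), hypothesis (P) restricted to the fibre
  haveI := isFiniteMeasure_orthoTransverse L
  have hae : ∀ᵐ v ∂orthoTransverse L, v ∈ capBalancedSet L := by rw [ae_iff]; exact orthoTransverse_compl_capBalancedSet L
  set h : (Edge 3 L → Fin 3 → ℝ) → ℝ := fun v => Ω (linkEmbed L v) ^ 2 * Real.exp (‖(gaugeModes L).starProjection (linkEmbed L v)‖ ^ 2 / δg ^ 2) with hh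
  have hpt : ∀ v ∈ capBalancedSet L, Ω (linkEmbed L v) ^ 2 * softWeight χ (orthoTube L u v) = h v * gaugeAvg χ (orthoTube L u v) := by
    intro v hv
    by_cases hΩ0 : Ω (linkEmbed L v) = 0
    · simp only [hh, hΩ0]; ring
    · have hF := (hu v hv hΩ0).1
      unfold softWeight
      rw [hχ (orthoTube L u v), Set.indicator_of_mem hF, one_mul, gaugeCoordSq_orthoTube u hv, hh]
      have hex : Real.exp (-(‖(gaugeModes L).starProjection (linkEmbed L v)‖ ^ 2 / δg ^ 2)) ≠ 0 := (Real.exp_pos _).ne'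
      field_simp
      rw [mul_assoc, ← Real.exp_add, neg_add_cancel, Real.exp_zero, mul_one]
  have hCΩ0 : 0 ≤ CΩ := (abs_nonneg _).trans (hCΩ 0)
  have hh0 : ∀ v, 0 ≤ h v := fun v => by simp only [hh]; positivity
  have hhb : ∀ v, h v ≤ CΩ ^ 2 * Real.exp (R ^ 2 / δg ^ 2) := fun v => by
    simp only [hh]
    by_cases hΩ0 : Ω (linkEmbed L v) = 0
    · rw [hΩ0]; simp only [ne_eq, OfNat.ofNat_ne_zero, not_false_eq_true, zero_pow, zero_mul]; positivity
    · have hxR := hΩR _ hΩ0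
      have hP : ‖(gaugeModes L).starProjection (linkEmbed L v)‖ ≤ R :=
        (Submodule.norm_starProjection_apply_le (gaugeModes L) (linkEmbed L v)).trans hxR
      have hR0 : 0 ≤ R := (norm_nonneg _).trans hxR
      refine mul_le_mul (by rw [← sq_abs]; exact pow_le_pow_left₀ (abs_nonneg _) (hCΩ _) 2) (Real.exp_le_exp.mpr ?_) (Real.exp_pos _).le (by positivity)
      exact div_le_div_of_nonneg_right (pow_le_pow_left₀ (norm_nonneg _) hP 2) (sq_nonneg _)
  have hhm : Measurable h := by
    simp only [hh]
    exact ((hΩ.comp (measurable_linkEmbed L)).pow_const 2).mul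
      ((((gaugeModes L).starProjection.continuous.measurable.comp (measurable_linkEmbed L)).norm.pow_const 2).div_const _ |>.exp)
  have hχb : ∀ U, |χ U| ≤ 1 := fun U => by
    rw [hχ U]
    have h1 : (F.indicator (fun _ => (1 : ℝ)) U) ∈ Set.Icc (0 : ℝ) 1 := ⟨Set.indicator_nonneg (fun _ _ => zero_le_one) U, Set.indicator_le_self' (fun _ _ => zero_le_one) U⟩
    have h2 : Real.exp (-(gaugeCoordSq L U / δg ^ 2)) ≤ 1 := Real.exp_le_one_iff.mpr (by
      have h0 := gaugeCoordSq_nonneg L U; have : 0 ≤ gaugeCoordSq L U / δg ^ 2 := div_nonneg h0 (sq_nonneg _); linarith)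
    rw [abs_le]; constructor
    · have := mul_nonneg h1.1 (Real.exp_pos (-(gaugeCoordSq L U / δg ^ 2))).le; linarith
    · calc F.indicator (fun _ => (1 : ℝ)) U * Real.exp (-(gaugeCoordSq L U / δg ^ 2)) ≤ 1 * 1 := mul_le_mul h1.2 h2 (Real.exp_pos _).le zero_le_one
        _ = 1 := one_mul 1
  have hNm : Measurable fun v : Edge 3 L → Fin 3 → ℝ => gaugeAvg χ (orthoTube L u v) := (measurable_gaugeAvg hχm).comp (measurable_orthoTube_right u)
  have hNb : ∀ v : Edge 3 L → Fin 3 → ℝ, |gaugeAvg χ (orthoTube L u v)| ≤ 1 := fun v => abs_gaugeAvg_le hχm hχb _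
  have hiH : Integrable (fun v => h v * gaugeAvg χ (orthoTube L u v)) (orthoTransverse L) :=
    integrable_of_measurable_abs_le _ (hhm.mul hNm) (C := CΩ ^ 2 * Real.exp (R ^ 2 / δg ^ 2) * 1) fun v => by
      rw [abs_mul, abs_of_nonneg (hh0 v)]; exact mul_le_mul (hhb v) (hNb v) (abs_nonneg _) (by positivity)
  have hih : Integrable h (orthoTransverse L) := integrable_of_measurable_abs_le _ hhm (C := CΩ ^ 2 * Real.exp (R ^ 2 / δg ^ 2)) fun v => by
    rw [abs_of_nonneg (hh0 v)]; exact hhb v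
  have hfm : fibreMass L (softWeight χ) Ω u = ∫ v, h v * gaugeAvg χ (orthoTube L u v) ∂orthoTransverse L := by
    unfold fibreMass; exact integral_congr_ae (hae.mono fun v hv => hpt v hv)
  have hγ : boGamma L Ω δg Nbar = Nbar * ∫ v, h v ∂orthoTransverse L := rfl
  have hI0 : 0 ≤ ∫ v, h v ∂orthoTransverse L := integral_nonneg hh0
  have hup : ∫ v, h v * gaugeAvg χ (orthoTube L u v) ∂orthoTransverse L ≤ ∫ v, h v * (Nbar * (1 + κ)) ∂orthoTransverse L := by
    refine integral_mono_ae hiH (hih.mul_const _) (hae.mono fun v hv => ?_)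
    by_cases hΩ0 : Ω (linkEmbed L v) = 0
    · have : h v = 0 := by simp only [hh, hΩ0]; ring
      simp only [this, zero_mul, le_refl]
    · exact mul_le_mul_of_nonneg_left (hu v hv hΩ0).2.2 (hh0 v)
  have hlo : ∫ v, h v * (Nbar * (1 - κ)) ∂orthoTransverse L ≤ ∫ v, h v * gaugeAvg χ (orthoTube L u v) ∂orthoTransverse L := by
    refine integral_mono_ae (hih.mul_const _) hiH (hae.mono fun v hv => ?_)
    by_cases hΩ0 : Ω (linkEmbed L v) = 0
    · have : h v = 0 := by simp only [hh, hΩ0]; ring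
      simp only [this, zero_mul, le_refl]
    · exact mul_le_mul_of_nonneg_left (hu v hv hΩ0).2.1 (hh0 v)
  rw [integral_mul_const] at hup hlo
  rw [hfm, hγ, abs_le]
  constructor <;> nlinarith [hup, hlo, hI0]

/-! ## §2 Algebra of the ratio -/

/-- `|a − γ| ≤ κ₁γ`, `|b − γ| ≤ κ₂γ`, `κ₂ ≤ ½`, `0 < γ` ⇒ `0 < b` and `|a/b − 1| ≤ 2(κ₁ + κ₂)`. [folklore] -/
theorem abs_div_sub_one_le_of_near {a b γ κ₁ κ₂ : ℝ} (ha : |a - γ| ≤ κ₁ * γ) (hb : |b - γ| ≤ κ₂ * γ) (hκ₂ : κ₂ ≤ 1 / 2) (hγ : 0 < γ) :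
    0 < b ∧ |a / b - 1| ≤ 2 * (κ₁ + κ₂) := by
  obtain ⟨hb1, hb2⟩ := abs_le.mp hb
  obtain ⟨ha1, ha2⟩ := abs_le.mp ha
  have hbγ : γ / 2 ≤ b := by nlinarith
  have hb0 : 0 < b := by linarith
  refine ⟨hb0, ?_⟩
  have e : a / b - 1 = (a - b) / b := by field_simp
  rw [e, abs_div, abs_of_pos hb0, div_le_iff₀ hb0]
  have hab : |a - b| ≤ (κ₁ + κ₂) * γ := by
    rw [show a - b = (a - γ) - (b - γ) by ring]
    exact (abs_sub _ _).trans (by linarith)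
  have hk0 : 0 ≤ (κ₁ + κ₂) * γ := (abs_nonneg _).trans hab
  have hk : 0 ≤ κ₁ + κ₂ := nonneg_of_mul_nonneg_left hk0 hγ
  nlinarith

/-! ## §3 ★★★ The fibre mass pointwise, from the pointwise FP sandwich -/

/-- `|Edge 3 L| ≥ 1`. [folklore] -/
theorem one_le_card_edge : (1 : ℝ) ≤ Fintype.card (Edge 3 L) := by
  have : 0 < Fintype.card (Edge 3 L) := Fintype.card_pos_iff.mpr ⟨((fun _ => 0), 0)⟩
  exact_mod_cast this

set_option maxHeartbeats 800000 in
/-- ★★★ **THE FIBRE MASS POINTWISE AT RATE (fixed `β`).**  Record weight `χ = recordWeightRho δ ρ δg β`, `N̄ = fpWeightBar (δg β)`; ASSUME the pointwise FP sandwich on the fat tube: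
for `U ∈ fatTubeRho δ ρ β` and `0 < τ ≤ δ β` with `‖U_e − 1‖_F ≤ τ`: `N̄(1 − C(a + τ²)) ≤ N(U) ≤ N̄(1 + C(a + τ²))` (`C ≥ 0`).  Frozen profile `Ω` (measurable, `|Ω| ≤ 1`, support
`‖x‖ ≤ R`, `0 < R`), window radius `δ₁ ≥ 0` with `|Edge|(4R + δ₁) < δ β ≤ min(ρ β, 1/8)`.  Then for `orbitDist u ≤ δ₁`:  `|mass(u) − γ| ≤ C(a + (4R + orbitDist u)²)·γ`
(`mass = fibreMass (N/χ) Ω`, `γ = boGamma Ω (δg β) N̄`); and if moreover `γ > 0` and `C(a + (4R)²) ≤ ½`: `0 < mass(1)` and `|mass(u)/mass(1) − 1| ≤ 4C·orbitDist(u)² + (4Ca + 96C·R²)`.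
[cite: Luscher1983, §3] -/
theorem fibreMass_pointwise_of_sandwich {δ ρ δg : ℝ → ℝ} {β C a : ℝ} (hC0 : 0 ≤ C)
    (hpt : ∀ U ∈ fatTubeRho L δ ρ β, ∀ τ : ℝ, 0 < τ → τ ≤ δ β → (∀ e : Edge 3 L, frobNorm (((U e : SU2) : Matrix (Fin 2) (Fin 2) ℂ) - 1) ≤ τ) →
      fpWeightBar L (δg β) * (1 - C * (a + τ ^ 2)) ≤ gaugeAvg (recordWeightRho L δ ρ δg β) U ∧
        gaugeAvg (recordWeightRho L δ ρ δg β) U ≤ fpWeightBar L (δg β) * (1 + C * (a + τ ^ 2)))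
    {Ω : LinkSpace L → ℝ} (hΩm : Measurable Ω) (hΩ1 : ∀ x, |Ω x| ≤ 1) {R : ℝ} (hΩR : ∀ x, Ω x ≠ 0 → ‖x‖ ≤ R) (hR0 : 0 < R)
    {δ₁ : ℝ} (hδ₁ : 0 ≤ δ₁) (hwin : Fintype.card (Edge 3 L) * (4 * R + δ₁) < δ β) (hρ : δ β ≤ ρ β) (hδ8 : δ β ≤ 1 / 8)
    {u : GaugeConfig 3 1 SU2} (hu : orbitDist u ≤ δ₁) :
    |fibreMass L (softWeight (recordWeightRho L δ ρ δg β)) Ω u - boGamma L Ω (δg β) (fpWeightBar L (δg β))| ≤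
        C * (a + (4 * R + orbitDist u) ^ 2) * boGamma L Ω (δg β) (fpWeightBar L (δg β)) ∧
      (0 < boGamma L Ω (δg β) (fpWeightBar L (δg β)) → C * (a + (4 * R) ^ 2) ≤ 1 / 2 →
        0 < fibreMass L (softWeight (recordWeightRho L δ ρ δg β)) Ω 1 ∧
        |fibreMass L (softWeight (recordWeightRho L δ ρ δg β)) Ω u / fibreMass L (softWeight (recordWeightRho L δ ρ δg β)) Ω 1 - 1| ≤
          4 * C * orbitDist u ^ 2 + (4 * C * a + 96 * C * R ^ 2)) := by
  have hE := one_le_card_edge (L := L)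
  -- geometry of the window: `4R + δ₁ ≤ δ β < ρ β`, `R ≤ 1/2`
  have h4Rδ : 4 * R + δ₁ < δ β := by nlinarith only [hwin, hE, hR0, hδ₁]
  have hρ' : 4 * R + δ₁ < ρ β := lt_of_lt_of_le h4Rδ hρ
  have hR2 : R ≤ 1 / 2 := by linarith only [h4Rδ, hδ8, hδ₁, hR0]
  -- the sandwich along the fibre over any `u'` in the window
  have hsand : ∀ u' : GaugeConfig 3 1 SU2, orbitDist u' ≤ δ₁ →
      |fibreMass L (softWeight (recordWeightRho L δ ρ δg β)) Ω u' - boGamma L Ω (δg β) (fpWeightBar L (δg β))| ≤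
        C * (a + (4 * R + orbitDist u') ^ 2) * boGamma L Ω (δg β) (fpWeightBar L (δg β)) := by
    intro u' hu'
    refine fibreMass_sandwich_at (F := fatTubeRho L δ ρ β) (fun _ => rfl) (measurable_recordWeightRho L δ ρ δg β) hΩm hΩ1 hΩR fun v hv hΩ0 => ?_
    have hmem : orthoTube L u' v ∈ fatTubeRho L δ ρ β := orthoTube_mem_fatTubeRho hu' hR2 hΩR hρ' hwin v hΩ0
    have hve : ∀ e, ‖v e‖ ≤ R := fun e => (norm_apply_le_norm_linkEmbed v e).trans (hΩR _ hΩ0)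
    have hlink : ∀ e : Edge 3 L, frobNorm (((orthoTube L u' v e : SU2) : Matrix (Fin 2) (Fin 2) ℂ) - 1) ≤ 4 * R + orbitDist u' :=
      fun e => frobNorm_orthoTube_sub_one_le' le_rfl hR2 hve e
    have hτ0 : 0 < 4 * R + orbitDist u' := by have := orbitDist_nonneg u'; linarith only [this, hR0]
    have hτt : 4 * R + orbitDist u' ≤ δ β := by linarith only [h4Rδ, hu']
    exact ⟨hmem, hpt _ hmem _ hτ0 hτt hlink⟩
  refine ⟨hsand u hu, fun hγ hκ1 => ?_⟩
  -- the ratio against `u = 1`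
  have h1 : orbitDist (1 : GaugeConfig 3 1 SU2) ≤ δ₁ := by
    rw [show (1 : GaugeConfig 3 1 SU2) = fun _ => (1 : SU2) from rfl, orbitDist_one]; exact hδ₁
  have hs1 := hsand 1 h1
  rw [show orbitDist (1 : GaugeConfig 3 1 SU2) = 0 by rw [show (1 : GaugeConfig 3 1 SU2) = fun _ => (1 : SU2) from rfl, orbitDist_one], add_zero] at hs1
  have hsu := hsand u hu
  have hd0 := orbitDist_nonneg u
  obtain ⟨hpos, hq⟩ := abs_div_sub_one_le_of_near hsu hs1 hκ1 hγ
  refine ⟨hpos, hq.trans ?_⟩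
  have hsq : (4 * R + orbitDist u) ^ 2 ≤ 2 * ((4 * R) ^ 2 + orbitDist u ^ 2) := by nlinarith only [sq_nonneg (4 * R - orbitDist u)]
  have := mul_le_mul_of_nonneg_left hsq hC0
  nlinarith only [this, hC0, sq_nonneg R, sq_nonneg (orbitDist u), hd0]

end Summit.QuantumFields.YangMills.Theorems.FemtoTransferGap.TwoLattice.ConstTube

end
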